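import Literature.NumberTheory.LFunctions.UnconditionalPairCorrelationKernel
import Literature.NumberTheory.LFunctions.MontgomeryExplicitFormulaProofs
import Literature.NumberTheory.LFunctions.ZetaZeroReciprocalSum
import HarnessLib

/-!
RH-FREE — «nothing here bears on the truth of RH».

# Montgomery's explicit formula with the real parts of the zeros kept
# (Baluyot–Goldston–Suriajaya–Turnage-Butterbaugh, Acta Arith. 214 (2024), Lemma 1)

Topic `Literature/NumberTheory/LFunctions` (namespace `Literature.NumberTheory.LFunctions`, paper
objects in `BGSTB2024`). PROOF LAYER: no named facts; the only `def` is the zero side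
`BGSTB2024.zeroKernelSeries` (with body). Second proof file for the discharge of the unconditional
Montgomery theorem `Literature.NumberTheory.LFunctions.baluyotEtAl2025_montgomeryTheorem`; status note
(no endorsement): Lemma 1 is Montgomery's 1973 Lemma with `δ = β − 1/2` kept, in a refereed paper.

BGST 2024, Lemma 1 (Montgomery): "Let `ρ = 1/2 + δ + iγ`. Then for `x ≥ 1` and all `t` we have
`Σ_ρ 2x^{δ+i(γ−t)}/(1+((t−γ)+iδ)²) = −Σ_{n≥1} Λ(n) n^{−1/2−it} min{n/x, x/n}
 + x^{−1}(log(|t|+2) + O(1)) + O(x^{1/2}/(1+t²)) + O(x^{−5/2}/(|t|+2))`." Multiplying by `x^{1/2}`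
this is Goldston's (3.11) with the sum over the zeros kept complex, which is the shape proved here
(directly usable with the tree's mean-value machinery for the right-hand side):

* `BGSTB2024.zeroKernelSeries x t = Σ_ρ m(ρ) x^{ρ−1/2} K(ρ−½, t)` over ALL non-trivial zeros with
  multiplicity, `K(a,t) = 1/(1−(a−it)²)` (`BGSTB2024.kernel`); absolutely convergent
  (`BGSTB2024.summable_zeroKernelTerm`: `‖K(ρ−½,t)‖ ≤ 4/(1+(t−γ)²) ≤ 8(1+t²)/(1+γ²)` and
  `Σ m(ρ)/(1+γ²) < ∞`, `ZetaZeroSum.summable_zeroOrder_div_one_add_sq`). ON the critical line it is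
  Montgomery's `S(x,t) = Σ_γ x^{iγ}/(1+(t−γ)²)` (`montgomeryZeroSum`).
* `BGSTB2024.two_pi_mul_zeroKernelSeries_eq_lineIntegral` — the RH-FREE contour argument: the
  tree's `Montgomery.zeroSidePartial_eq_contour` (weighted argument principle for `ξ` on
  `[−1/4, 5/4] × [−T, T]`, `MontgomeryExplicitFormulaContour.lean`) at the unconditional good
  heights `ZetaZeroSum.exists_goodHeight_log` (`1/η ≪ log T`), the horizontal sides
  `≪ x^{5/4} log²T/T → 0` (`Montgomery.norm_horizontal_le` with `exists_norm_logDeriv_riemannXi_le`),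
  and the truncated zero sides `Σ_{|Im ρ| ≤ T} m(ρ) x^ρ k(ρ) = 2x^{1/2} Σ_{|Im ρ|≤T} m(ρ) x^{ρ−1/2} K`
  converging to the absolutely convergent series: `2π · 2x^{1/2} S_u(x,t) = ∫ (ξ'/ξ)(5/4+iy)[r(s)+r(1−s)] dy`.
  (Under RH this is the tree's `Montgomery.two_pi_mul_zeroSum_eq_lineIntegral`, whose only uses of RH
  were the choice of good heights and the rewriting `ρ = 1/2 + iγ`.)
* `baluyotEtAl2024_lemma1` — **Lemma 1 in the shape (3.11)**: there is an absolute `C` with, for all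
  `x ≥ 1` and real `t`, `E₁, E₂` with `‖E₁‖ ≤ C`, `‖E₂‖ ≤ C x^{−2}/(|t|+2)` and
  `2x^{1/2−it} S_u(x,t) = −A(x,t) + 2x^{1−it}/((1/2+it)(3/2−it)) + x^{−1/2}(log(|t|+2) + E₁) + E₂`,
  `A(x,t) = Σ Λ(n) a_n(x) n^{−it}` (`montgomeryDirichletSum`); the evaluation of the line integral and
  the two remainder bounds are the tree's (`integral_logDeriv_riemannXi_mul_kernels`,
  `Montgomery.exists_norm_gammaTerms_sub_log_le`, `Montgomery.norm_trivialZeroSeries_le`).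

## References

* [BaluyotEtAl2024] Acta Arith. 214 (2024) 357–376 = arXiv:2306.04799, §2, Lemma 1 and its proof
  ("This is the Lemma from [Montgomery73] if one takes `σ = 3/2` and `δ = 0` … Landau's explicit
  formula … Taking `σ = 3/2` gives the left-hand side"); held text `paper:arxiv-2306.04799` p0004.
* [Goldston2005] D. A. Goldston, *Notes on pair correlation of zeros and prime numbers*,
  Proposition 1 (3.11) (the RH shape; tree: `montgomery_explicit_formula_holds`).
* [Montgomery1973] H. L. Montgomery, *The pair correlation of zeros of the zeta function*, Lemma.
-/

noncomputable section

open Complex Filter Set MeasureTheory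
open ArithmeticFunction hiding log id
open scoped Real Topology ComplexConjugate

namespace Literature.NumberTheory.LFunctions

namespace BGSTB2024

/-! ## §1. The zero side over all non-trivial zeros -/

/-- The `ρ`-th term of the zero side: `m(ρ) x^{ρ−1/2} K(ρ−½, t)`.
[cite: BaluyotEtAl2024, Lemma 1 (left-hand side)] -/
def zeroKernelTerm (x t : ℝ) (ρ : ℂ) : ℂ :=
  (mult ρ : ℂ) * (x : ℂ) ^ (ρ - 1 / 2) * kernel (ρ - 1 / 2) t

/-- **`S_u(x,t) = Σ_ρ m(ρ) x^{ρ−1/2} K(ρ−½,t)`**, the sum over ALL non-trivial zeros of `ζ` with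
multiplicity (absolutely convergent, `summable_zeroKernelTerm`): one half of `x^{−1/2}` times the
left-hand side `Σ_ρ 2x^{δ+i(γ−t)}/(1+((t−γ)+iδ)²)` of BGST 2024, Lemma 1, multiplied by `x^{it}`.
On the critical line it is Montgomery's `S(x,t) = Σ_γ x^{iγ}/(1+(t−γ)²)`.
[cite: BaluyotEtAl2024, Lemma 1 (left-hand side)] -/
def zeroKernelSeries (x t : ℝ) : ℂ :=
  ∑' ρ : ZetaZeros.riemannZetaNontrivialZeros, zeroKernelTerm x t ρ

/-- `1/(1+(t−γ)²) ≤ 2(1+t²)/(1+γ²)`. [folklore] -/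
private theorem inv_one_add_sq_sub_le (t γ : ℝ) :
    1 / (1 + (t - γ) ^ 2) ≤ 2 * (1 + t ^ 2) / (1 + γ ^ 2) := by
  rw [div_le_div_iff₀ (by positivity) (by positivity)]
  nlinarith [sq_nonneg (γ - 2 * t), sq_nonneg (t * (t - γ)), sq_nonneg t, sq_nonneg (t - γ),
    sq_nonneg (t * (t - γ) - 1), sq_nonneg (γ - t - t)]

/-- For `x ≥ 1` and `|Re ρ − 1/2| ≤ 1/2`: `‖x^{ρ−1/2}‖ ≤ x^{1/2}` (the source's `x^δ ≤ x^{1/2}`).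
[cite: BaluyotEtAl2024, §2 (trivialestimate)] -/
theorem norm_cpow_sub_half_le {x : ℝ} (hx : 1 ≤ x) {ρ : ℂ} (hρ : |(ρ - 1 / 2).re| ≤ 1 / 2) :
    ‖(x : ℂ) ^ (ρ - 1 / 2)‖ ≤ x ^ (1 / 2 : ℝ) := by
  have hx0 : 0 < x := one_pos.trans_le hx
  rw [norm_cpow_eq_rpow_re_of_pos hx0]
  exact Real.rpow_le_rpow_of_exponent_le hx (abs_le.1 hρ).2

/-- Termwise bound: `‖m(ρ) x^{ρ−1/2} K(ρ−½,t)‖ ≤ 8 x^{1/2}(1+t²) · m(ρ)/(1+γ²)` for `x ≥ 1`.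
[cite: BaluyotEtAl2024, §2 (trivialestimate)] -/
theorem norm_zeroKernelTerm_le {x : ℝ} (hx : 1 ≤ x) (t : ℝ) {ρ : ℂ}
    (hρ : ρ ∈ ZetaZeros.riemannZetaNontrivialZeros) :
    ‖zeroKernelTerm x t ρ‖ ≤
      8 * x ^ (1 / 2 : ℝ) * (1 + t ^ 2) * ((mult ρ : ℝ) / (1 + ρ.im ^ 2)) := by
  have ha : |(ρ - 1 / 2).re| ≤ 1 / 2 := (abs_re_sub_half_lt hρ).le
  have h1 := norm_cpow_sub_half_le hx ha
  have h2 := norm_kernel_le ha t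
  have him : (ρ - 1 / 2).im = ρ.im := by simp
  rw [him] at h2
  have h3 := inv_one_add_sq_sub_le t ρ.im
  unfold zeroKernelTerm
  rw [norm_mul, norm_mul, Complex.norm_natCast]
  have hm : (0 : ℝ) ≤ mult ρ := Nat.cast_nonneg _
  have hx12 : 0 ≤ x ^ (1 / 2 : ℝ) := by positivity
  calc (mult ρ : ℝ) * ‖(x : ℂ) ^ (ρ - 1 / 2)‖ * ‖kernel (ρ - 1 / 2) t‖
      ≤ (mult ρ : ℝ) * x ^ (1 / 2 : ℝ) * (4 / (1 + (t - ρ.im) ^ 2)) :=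
        mul_le_mul (mul_le_mul_of_nonneg_left h1 hm) h2 (norm_nonneg _) (by positivity)
    _ ≤ (mult ρ : ℝ) * x ^ (1 / 2 : ℝ) * (4 * (2 * (1 + t ^ 2) / (1 + ρ.im ^ 2))) := by
        refine mul_le_mul_of_nonneg_left ?_ (by positivity)
        have := mul_le_mul_of_nonneg_left h3 (by norm_num : (0 : ℝ) ≤ 4)
        simpa [div_eq_mul_inv] using this
    _ = 8 * x ^ (1 / 2 : ℝ) * (1 + t ^ 2) * ((mult ρ : ℝ) / (1 + ρ.im ^ 2)) := by ring

/-- The multiplicity as a real number is the order of the zero (non-trivial zeros have `m ≥ 1`).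
[cite: BaluyotEtAl2024, §1 («zeros are counted with multiplicity»)] -/
theorem mult_eq_order {ρ : ℂ} (hρ : ρ ∈ ZetaZeros.riemannZetaNontrivialZeros) :
    (mult ρ : ℝ) = (riemannZetaZeroOrder ρ : ℝ) := by
  have h := ZetaZeros.riemannZetaNontrivialZeros.one_le_order hρ
  unfold mult
  have : ((riemannZetaZeroOrder ρ).toNat : ℤ) = riemannZetaZeroOrder ρ := Int.toNat_of_nonneg (by omega)
  exact_mod_cast this

/-- **Absolute convergence of the zero side**: `Σ_ρ ‖m(ρ) x^{ρ−1/2} K(ρ−½,t)‖ < ∞` for `x ≥ 1`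
(from `Σ m(ρ)/(1+γ²) < ∞`, `ZetaZeroSum.summable_zeroOrder_div_one_add_sq`).
[cite: BaluyotEtAl2024, §2 (trivialestimate)] -/
theorem summable_norm_zeroKernelTerm {x : ℝ} (hx : 1 ≤ x) (t : ℝ) :
    Summable fun ρ : ZetaZeros.riemannZetaNontrivialZeros ↦ ‖zeroKernelTerm x t ρ‖ := by
  have hS : Summable fun ρ : ZetaZeros.riemannZetaNontrivialZeros ↦
      (riemannZetaZeroOrder (ρ : ℂ) : ℝ) / (1 + (ρ : ℂ).im ^ 2) :=
    ZetaZeroSum.summable_zeroOrder_div_one_add_sq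
  refine Summable.of_nonneg_of_le (fun _ ↦ norm_nonneg _) (fun ρ ↦ ?_)
    (hS.mul_left (8 * x ^ (1 / 2 : ℝ) * (1 + t ^ 2)))
  have h := norm_zeroKernelTerm_le hx t ρ.2
  rwa [mult_eq_order ρ.2] at h

/-- The zero side converges absolutely (`x ≥ 1`). [cite: BaluyotEtAl2024, §2 (trivialestimate)] -/
theorem summable_zeroKernelTerm {x : ℝ} (hx : 1 ≤ x) (t : ℝ) :
    Summable fun ρ : ZetaZeros.riemannZetaNontrivialZeros ↦ zeroKernelTerm x t ρ :=
  (summable_norm_zeroKernelTerm hx t).of_norm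

/-- A finite sum over `weilZeroIndex T` is the `Finset` sum over `weilZeroFinset T` (the same set
inside the subtype of non-trivial zeros). [folklore] -/
private theorem finsum_weilZeroIndex_eq_sum (f : ℂ → ℂ) (T : ℝ) :
    ∑ᶠ ρ ∈ weilZeroIndex T, f ρ = ∑ ρ ∈ weilZeroFinset T, f ρ := by
  classical
  have e : ∑ ρ ∈ weilZeroFinset T, f ρ =
      ∑ z ∈ (weilZeroFinset T).map (Function.Embedding.subtype _), f z := by
    rw [Finset.sum_map]
    rfl
  rw [e, finsum_mem_eq_finite_toFinset_sum _ (weilZeroIndex_finite T)]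
  refine Finset.sum_congr ?_ fun _ _ ↦ rfl
  ext z
  simp only [Set.Finite.mem_toFinset, Finset.mem_map, Function.Embedding.subtype_apply]
  constructor
  · intro hz
    have hz' : z ∈ ZetaZeros.riemannZetaNontrivialZeros := by
      rw [weilZeroIndex_eq_inter] at hz; exact hz.1
    refine ⟨⟨z, hz'⟩, ?_, rfl⟩
    rw [mem_weilZeroFinset]
    rw [weilZeroIndex_eq_inter] at hz
    exact hz.2
  · rintro ⟨ρ, hρ, rfl⟩
    rw [weilZeroIndex_eq_inter]
    exact ⟨ρ.2, mem_weilZeroFinset.1 hρ⟩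

/-- The explicit-formula weight at a zero is twice the kernel:
`x^ρ (1/(ρ−s₁) − 1/(ρ−s₂)) = 2x^{1/2} · x^{ρ−1/2} K(ρ−½,t)`, `s₁ = −1/2+it`, `s₂ = 3/2+it`
(`ρ − s₁ = 1 + a − it`, `ρ − s₂ = −(1 − a + it)`, `a = ρ − 1/2`).
[cite: BaluyotEtAl2024, Lemma 1 (proof: «Taking σ = 3/2 gives the left-hand side»)] -/
theorem weight_eq_two_mul_kernel {x : ℝ} (hx : 0 < x) (t : ℝ) {ρ : ℂ} (hρ : |(ρ - 1 / 2).re| < 1) :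
    (x : ℂ) ^ ρ * (1 / (ρ - (-1 / 2 + t * I)) - 1 / (ρ - (3 / 2 + t * I))) =
      2 * (x : ℂ) ^ (1 / 2 : ℂ) * ((x : ℂ) ^ (ρ - 1 / 2) * kernel (ρ - 1 / 2) t) := by
  have hx0 : (x : ℂ) ≠ 0 := ofReal_ne_zero.2 hx.ne'
  have e1 : ρ - (-1 / 2 + t * I) = 1 + (ρ - 1 / 2) - t * I := by ring
  have e2 : ρ - (3 / 2 + t * I) = -(1 - (ρ - 1 / 2) + t * I) := by ring
  have h1 := one_add_sub_ne_zero (abs_lt.1 hρ).1 t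
  have h2 := one_sub_add_ne_zero (abs_lt.1 hρ).2 t
  have epow : (x : ℂ) ^ ρ = (x : ℂ) ^ (1 / 2 : ℂ) * (x : ℂ) ^ (ρ - 1 / 2) := by
    rw [← cpow_add _ _ hx0]; congr 1; ring
  rw [e1, e2, one_div_neg_eq_neg_one_div, sub_neg_eq_add, kernel_eq_half_add hρ, epow]
  ring

/-- The truncated zero side of the contour theorem is the partial sum of `2x^{1/2} S_u` over
`|Im ρ| ≤ T`. [cite: BaluyotEtAl2024, Lemma 1 (proof)] -/
theorem zeroSidePartial_eq_sum_weilZeroFinset {x : ℝ} (hx : 0 < x) (t T : ℝ) :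
    ∑ᶠ ρ ∈ weilZeroIndex T, (riemannZetaZeroOrder ρ : ℂ) *
        ((x : ℂ) ^ ρ * (1 / (ρ - (-1 / 2 + t * I)) - 1 / (ρ - (3 / 2 + t * I)))) =
      2 * (x : ℂ) ^ (1 / 2 : ℂ) * ∑ ρ ∈ weilZeroFinset T, zeroKernelTerm x t ρ := by
  rw [finsum_weilZeroIndex_eq_sum, Finset.mul_sum]
  refine Finset.sum_congr rfl fun ρ _ ↦ ?_
  have hρ1 : |((ρ : ℂ) - 1 / 2).re| < 1 := (abs_re_sub_half_lt ρ.2).trans (by norm_num)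
  have hm : (riemannZetaZeroOrder (ρ : ℂ) : ℂ) = (mult (ρ : ℂ) : ℂ) := by
    have h := mult_eq_order ρ.2
    exact_mod_cast h.symm
  rw [weight_eq_two_mul_kernel hx t hρ1, hm, zeroKernelTerm]
  ring

/-! ## §2. The contour argument without RH -/

/-- **The unconditional contour identity**: for `x ≥ 1` and real `t`,
`2π · 2x^{1/2} S_u(x,t) = ∫_ℝ (ξ'/ξ)(5/4+iy)[r(5/4+iy) + r(1−(5/4+iy))] dy`,
`r(s) = x^s(1/(s−s₁) − 1/(s−s₂))` — the weighted argument principle on `[−1/4,5/4] × [−T,T]`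
(`Montgomery.zeroSidePartial_eq_contour`) at the good heights of `ZetaZeroSum.exists_goodHeight_log`,
`T → ∞`: horizontal sides `≪ x^{5/4} log²T/T`, right edge absolutely convergent, zero side absolutely
convergent. No hypothesis on the real parts of the zeros.
[cite: BaluyotEtAl2024, Lemma 1 (proof: Landau's explicit formula at `σ` and `1 − σ`, `σ = 3/2`)] -/
theorem two_pi_mul_zeroKernelSeries_eq_lineIntegral {x : ℝ} (hx : 1 ≤ x) (t : ℝ) :
    2 * π * (2 * (x : ℂ) ^ (1 / 2 : ℂ) * zeroKernelSeries x t) =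
      ∫ y : ℝ, logDeriv riemannXi (((5 / 4 : ℝ) : ℂ) + y * I) *
        ((x : ℂ) ^ (((5 / 4 : ℝ) : ℂ) + y * I) *
            (1 / (((5 / 4 : ℝ) : ℂ) + y * I - (-1 / 2 + t * I)) -
              1 / (((5 / 4 : ℝ) : ℂ) + y * I - (3 / 2 + t * I))) +
          (x : ℂ) ^ (1 - ((((5 / 4 : ℝ) : ℂ)) + y * I)) *
            (1 / ((1 - ((((5 / 4 : ℝ) : ℂ)) + y * I)) - (-1 / 2 + t * I)) -
              1 / ((1 - ((((5 / 4 : ℝ) : ℂ)) + y * I)) - (3 / 2 + t * I)))) := by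
  have hx0 : 0 < x := one_pos.trans_le hx
  -- the integrand on the right edge is integrable
  have hint := Montgomery.integrable_logDeriv_riemannXi_mul_kernels hx t (c := 5 / 4) (by norm_num) (by norm_num)
  -- the weight
  obtain ⟨r, hr⟩ : ∃ r : ℂ → ℂ, r = fun s : ℂ ↦ (x : ℂ) ^ s *
      (1 / (s - (-1 / 2 + t * I)) - 1 / (s - (3 / 2 + t * I))) := ⟨_, rfl⟩
  have er : ∀ s : ℂ, (x : ℂ) ^ s * (1 / (s - (-1 / 2 + t * I)) - 1 / (s - (3 / 2 + t * I))) = r s := by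
    intro s; rw [hr]
  simp only [er] at hint ⊢
  set Z : ℂ := 2 * (x : ℂ) ^ (1 / 2 : ℂ) * zeroKernelSeries x t with hZdef
  -- good heights (unconditional, `1/η ≪ log N`)
  obtain ⟨A, hA, hgh⟩ := ZetaZeroSum.exists_goodHeight_log
  have hgh' : ∀ N : ℕ, ∃ T : ℝ, ((max N 2 : ℕ) : ℝ) ≤ T ∧ T ≤ (max N 2 : ℕ) + 1 ∧ ∃ η : ℝ, 0 < η ∧
      η ≤ 1 / 2 ∧ 1 / η ≤ A * Real.log ((max N 2 : ℕ) + 6) ∧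
      ∀ ρ ∈ RHWave0.riemannZetaNontrivialZeros, η ≤ |ρ.im - T| :=
    fun N ↦ hgh (max N 2) (le_max_right _ _)
  choose T hT1 hT2 η hη0 hη2 hηA hηZ using hgh'
  have hTN : ∀ N : ℕ, (N : ℝ) ≤ T N := fun N ↦
    le_trans (by exact_mod_cast le_max_left N 2) (hT1 N)
  have hT2' : ∀ N : ℕ, 2 ≤ T N := fun N ↦
    le_trans (by exact_mod_cast le_max_right N 2) (hT1 N)
  have hTtop : Tendsto T atTop atTop := tendsto_atTop_mono hTN tendsto_natCast_atTop_atTop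
  have hηZ' : ∀ N, ∀ ρ : ℂ, riemannZeta ρ = 0 → 0 < ρ.re → η N ≤ |ρ.im - T N| :=
    fun N ρ hζ h0 ↦ hηZ N ρ (ZetaZeros.riemannZetaNontrivialZeros.mem_of_re_pos hζ h0)
  have hgood : ∀ N, ∀ ρ ∈ ZetaZeros.riemannZetaNontrivialZeros, ρ.im ≠ T N ∧ ρ.im ≠ -T N :=
    fun N ρ hρ ↦ im_ne_of_good (hη0 N) (fun ρ' hρ' ↦ hηZ N ρ' hρ') hρ
  -- the pieces of the contour
  set bot : ℕ → ℂ := fun N ↦ ∫ σ : ℝ in (-(1 / 4) : ℝ)..(5 / 4),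
    logDeriv riemannXi (σ + (-T N : ℝ) * I) * r (σ + (-T N : ℝ) * I) with hbot
  set top : ℕ → ℂ := fun N ↦ ∫ σ : ℝ in (-(1 / 4) : ℝ)..(5 / 4),
    logDeriv riemannXi (σ + T N * I) * r (σ + T N * I) with htop
  set V : ℕ → ℂ := fun N ↦ ∫ y : ℝ in (-T N)..T N, logDeriv riemannXi (((5 / 4 : ℝ) : ℂ) + y * I) *
    (r (((5 / 4 : ℝ) : ℂ) + y * I) + r (1 - (((5 / 4 : ℝ) : ℂ) + y * I))) with hV
  set Vinf : ℂ := ∫ y : ℝ, logDeriv riemannXi (((5 / 4 : ℝ) : ℂ) + y * I) *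
    (r (((5 / 4 : ℝ) : ℂ) + y * I) + r (1 - (((5 / 4 : ℝ) : ℂ) + y * I))) with hVinf
  set S : ℕ → ℂ := fun N ↦ 2 * (x : ℂ) ^ (1 / 2 : ℂ) *
    ∑ ρ ∈ weilZeroFinset (T N), zeroKernelTerm x t ρ with hS
  -- the contour identity along the good heights
  have hident : ∀ N : ℕ, S N = (bot N - top N + I * V N) / (2 * π * I) := by
    intro N
    have hTpos : 0 < T N := by linarith [hT2' N]
    have h := Montgomery.zeroSidePartial_eq_contour hx0 t hTpos (hgood N)
    have h' := zeroSidePartial_eq_sum_weilZeroFinset hx0 t (T N)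
    simp only [er] at h h'
    rw [h'] at h
    have h2πI : (2 * π * I : ℂ) ≠ 0 := by simp [Real.pi_ne_zero, I_ne_zero]
    rw [eq_div_iff h2πI, mul_comm, h]
  -- the horizontal sides tend to `0`
  obtain ⟨C, hC0, hC⟩ := exists_norm_logDeriv_riemannXi_le
  -- the majorant `6 C A x^{5/4} · log(T+4) log(T+6) / T`
  have hmaj : Tendsto (fun N : ℕ ↦ 6 * C * A * x ^ (5 / 4 : ℝ) *
      (Real.log (T N + 4) * Real.log (T N + 6) / T N)) atTop (𝓝 0) := by
    -- `log(T+4) log(T+6)/T ≤ log(T+6)²/(T+6) · ((T+6)/T) ≤ 4 · log(T+6)²/(T+6)` for `T ≥ 2`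
    have h1 : Tendsto (fun u : ℝ ↦ Real.log u ^ 2 / u) atTop (𝓝 0) := by
      have := (Real.isLittleO_pow_log_id_atTop (n := 2)).tendsto_div_nhds_zero
      simpa using this
    have h2 : Tendsto (fun N : ℕ ↦ T N + 6) atTop atTop := tendsto_atTop_add_const_right _ _ hTtop
    have h3 : Tendsto (fun N : ℕ ↦ 4 * (Real.log (T N + 6) ^ 2 / (T N + 6))) atTop (𝓝 0) := by
      simpa using (h1.comp h2).const_mul 4
    have h4 : Tendsto (fun N : ℕ ↦ Real.log (T N + 4) * Real.log (T N + 6) / T N) atTop (𝓝 0) := by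
      refine squeeze_zero' (Eventually.of_forall fun N ↦ ?_) (Eventually.of_forall fun N ↦ ?_) h3
      · have : 0 ≤ Real.log (T N + 4) := Real.log_nonneg (by linarith [hT2' N])
        have : 0 ≤ Real.log (T N + 6) := Real.log_nonneg (by linarith [hT2' N])
        have : 0 < T N := by linarith [hT2' N]
        positivity
      · have hT := hT2' N
        have hT0 : 0 < T N := by linarith
        have hl4 : 0 ≤ Real.log (T N + 4) := Real.log_nonneg (by linarith)
        have hl6 : 0 ≤ Real.log (T N + 6) := Real.log_nonneg (by linarith)
        have hl46 : Real.log (T N + 4) ≤ Real.log (T N + 6) :=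
          Real.log_le_log (by linarith) (by linarith)
        rw [div_le_iff₀ hT0]
        have e : 4 * (Real.log (T N + 6) ^ 2 / (T N + 6)) * T N =
            Real.log (T N + 6) ^ 2 * (4 * T N / (T N + 6)) := by
          field_simp
        rw [e]
        have h46 : 1 ≤ 4 * T N / (T N + 6) := by
          rw [le_div_iff₀ (by linarith)]; linarith
        calc Real.log (T N + 4) * Real.log (T N + 6)
            ≤ Real.log (T N + 6) * Real.log (T N + 6) := mul_le_mul_of_nonneg_right hl46 hl6
          _ = Real.log (T N + 6) ^ 2 * 1 := by ring
          _ ≤ Real.log (T N + 6) ^ 2 * (4 * T N / (T N + 6)) :=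
              mul_le_mul_of_nonneg_left h46 (by positivity)
    rw [show (0 : ℝ) = 6 * C * A * x ^ (5 / 4 : ℝ) * 0 by ring]
    exact h4.const_mul _
  have hedge : ∀ e : ℝ, (e = 1 ∨ e = -1) → Tendsto (fun N : ℕ ↦ ∫ σ : ℝ in (-(1 / 4) : ℝ)..(5 / 4),
      logDeriv riemannXi (σ + (e * T N : ℝ) * I) * r (σ + (e * T N : ℝ) * I)) atTop (𝓝 0) := by
    intro e he
    rw [tendsto_zero_iff_norm_tendsto_zero]
    refine squeeze_zero' (Eventually.of_forall fun _ ↦ norm_nonneg _)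
      ((eventually_ge_atTop (⌈2 * |t|⌉₊ + 2)).mono fun N hN ↦ ?_) hmaj
    have hN' : (⌈2 * |t|⌉₊ : ℝ) + 2 ≤ N := by exact_mod_cast hN
    have hceil : 2 * |t| ≤ ⌈2 * |t|⌉₊ := Nat.le_ceil _
    have hTN2 : 2 ≤ T N := hT2' N
    have hTNt : |t| + 1 ≤ T N := by linarith [hTN N, abs_nonneg t]
    have hTN2t : 2 * |t| ≤ T N := by linarith [hTN N]
    have het : e * T N = T N ∨ e * T N = -T N := by
      rcases he with rfl | rfl
      · exact Or.inl (one_mul _)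
      · exact Or.inr (neg_one_mul _)
    have hη1 : η N ≤ 1 := (hη2 N).trans (by norm_num)
    have hb := Montgomery.norm_horizontal_le hx t hC hTN2 hTNt (hη0 N) hη1 (hηZ' N) het
    simp only [er] at hb
    refine hb.trans ?_
    -- `(3/2)·(C log(T+4)/η)·(2x^{5/4}/(T−|t|)) ≤ 6 C A x^{5/4} log(T+4) log(T+6)/T`
    have hT0 : 0 < T N := by linarith
    have hTt : 0 < T N - |t| := by linarith [abs_nonneg t]
    have hl4 : 0 ≤ Real.log (T N + 4) := Real.log_nonneg (by linarith)
    have hlogN : Real.log (((max N 2 : ℕ) : ℝ) + 6) ≤ Real.log (T N + 6) :=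
      Real.log_le_log (by positivity) (by linarith [hT1 N])
    have hinvη : 1 / η N ≤ A * Real.log (T N + 6) :=
      (hηA N).trans (mul_le_mul_of_nonneg_left hlogN hA.le)
    have hx54 : 0 ≤ x ^ (5 / 4 : ℝ) := by positivity
    have step1 : C * Real.log (T N + 4) / η N ≤ C * Real.log (T N + 4) * (A * Real.log (T N + 6)) := by
      rw [div_eq_mul_one_div]
      exact mul_le_mul_of_nonneg_left hinvη (by positivity)
    have step2 : 2 * x ^ (5 / 4 : ℝ) / (T N - |t|) ≤ 4 * x ^ (5 / 4 : ℝ) / T N := by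
      rw [div_le_div_iff₀ hTt hT0]
      nlinarith
    calc 3 / 2 * (C * Real.log (T N + 4) / η N * (2 * x ^ (5 / 4 : ℝ) / (T N - |t|)))
        ≤ 3 / 2 * (C * Real.log (T N + 4) * (A * Real.log (T N + 6)) * (4 * x ^ (5 / 4 : ℝ) / T N)) := by
          refine mul_le_mul_of_nonneg_left ?_ (by norm_num)
          have hl6 : 0 ≤ Real.log (T N + 6) := Real.log_nonneg (by linarith)
          exact mul_le_mul step1 step2 (div_nonneg (by positivity) hTt.le)
            (mul_nonneg (mul_nonneg hC0.le hl4) (mul_nonneg hA.le hl6))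
      _ = 6 * C * A * x ^ (5 / 4 : ℝ) * (Real.log (T N + 4) * Real.log (T N + 6) / T N) := by ring
  have hbot_lim : Tendsto bot atTop (𝓝 0) := by
    refine (hedge (-1) (Or.inr rfl)).congr fun N ↦ ?_
    simp [hbot]
  have htop_lim : Tendsto top atTop (𝓝 0) := by
    refine (hedge 1 (Or.inl rfl)).congr fun N ↦ ?_
    simp [htop]
  -- the right edge tends to the line integral
  have hV_lim : Tendsto V atTop (𝓝 Vinf) :=
    intervalIntegral_tendsto_integral hint (tendsto_neg_atTop_atBot.comp hTtop) hTtop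
  have hrhs : Tendsto (fun N ↦ (bot N - top N + I * V N) / (2 * π * I)) atTop
      (𝓝 ((0 - 0 + I * Vinf) / (2 * π * I))) :=
    ((hbot_lim.sub htop_lim).add (hV_lim.const_mul I)).div_const _
  -- the zero side tends to `Z`
  have hS_lim : Tendsto S atTop (𝓝 Z) := by
    have h1 := (summable_zeroKernelTerm hx t).hasSum.comp tendsto_weilZeroFinset
    have h2 := (h1.comp hTtop).const_mul (2 * (x : ℂ) ^ (1 / 2 : ℂ))
    refine h2.congr fun N ↦ ?_
    simp [hS]
  have hS' : Tendsto S atTop (𝓝 ((0 - 0 + I * Vinf) / (2 * π * I))) :=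
    hrhs.congr fun N ↦ (hident N).symm
  have hlim := tendsto_nhds_unique hS_lim hS'
  rw [hlim]
  have h2πI : (2 * π * I : ℂ) ≠ 0 := by simp [Real.pi_ne_zero, I_ne_zero]
  field_simp
  ring

/-! ## §3. Lemma 1 in the shape (3.11) -/

/-- **BGST 2024, Lemma 1 (Montgomery's explicit formula with the real parts of the zeros kept),
in Goldston's normalisation (3.11)**: there is an absolute `C` such that for all `x ≥ 1` and real `t`
there are `E₁, E₂` with `‖E₁‖ ≤ C`, `‖E₂‖ ≤ C x^{−2}/(|t|+2)` and
`2x^{1/2−it} S_u(x,t) = −A(x,t) + 2x^{1−it}/((1/2+it)(3/2−it)) + x^{−1/2}(log(|t|+2) + E₁) + E₂`,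
where `S_u(x,t) = Σ_ρ m(ρ) x^{ρ−1/2}/(1−(ρ−1/2−it)²)` (`BGSTB2024.zeroKernelSeries`) and
`A(x,t) = Σ Λ(n) a_n(x) n^{−it}`, `a_n(x) = min((n/x)^{1/2},(x/n)^{3/2})` (`montgomeryDirichletSum`).
Dividing by `x^{1/2}` gives the printed display ("`Σ_ρ 2x^{δ+i(γ−t)}/(1+((t−γ)+iδ)²) =
−Σ Λ(n) n^{−1/2−it} min{n/x, x/n} + x^{−1}(log(|t|+2)+O(1)) + O(x^{1/2}/(1+t²)) + O(x^{−5/2}/(|t|+2))`";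
note `a_n(x) x^{−1/2} = n^{−1/2} min(n/x, x/n)` and `|2x^{1/2−it}/((1/2+it)(3/2−it))| ≍ x^{1/2}/(1+t²)`).
ON the critical line (`ρ = 1/2+iγ`) it is the tree's `montgomery_explicit_formula_holds`.
[cite: BaluyotEtAl2024, Lemma 1] -/
theorem _root_.Literature.NumberTheory.LFunctions.baluyotEtAl2024_lemma1 :
    ∃ C : ℝ, ∀ x : ℝ, 1 ≤ x → ∀ t : ℝ, ∃ E₁ E₂ : ℂ,
      ‖E₁‖ ≤ C ∧ ‖E₂‖ ≤ C * (x ^ (-2 : ℝ) / (|t| + 2)) ∧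
        2 * (x : ℂ) ^ ((1 / 2 : ℂ) - t * I) * zeroKernelSeries x t =
          -montgomeryDirichletSum x t +
              2 * (x : ℂ) ^ ((1 : ℂ) - t * I) / ((1 / 2 + t * I) * (3 / 2 - t * I)) +
            (x : ℂ) ^ (-(1 / 2 : ℂ)) * (Real.log (|t| + 2) + E₁) + E₂ := by
  obtain ⟨C₁, hC₁⟩ := Montgomery.exists_norm_gammaTerms_sub_log_le
  refine ⟨max C₁ 8, fun x hx t ↦ ?_⟩
  have hx0 : 0 < x := one_pos.trans_le hx
  have hx0' : (x : ℂ) ≠ 0 := ofReal_ne_zero.2 hx0.ne'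
  have hB := two_pi_mul_zeroKernelSeries_eq_lineIntegral hx t
  have hA := Montgomery.integral_logDeriv_riemannXi_mul_kernels hx t (c := 5 / 4) (by norm_num) (by norm_num)
  rw [hA] at hB
  have h2π : (2 * π : ℂ) ≠ 0 := by simp [Real.pi_ne_zero]
  have key := mul_left_cancel₀ h2π hB
  -- abbreviations
  set G : ℂ := logDeriv Gammaℝ (-1 / 2 + t * I) + logDeriv Gammaℝ (1 - (-1 / 2 + t * I)) with hG
  set L : ℂ := LSeries (fun n ↦ (Λ n : ℂ)) (3 / 2 - t * I) with hL
  set R : ℂ := ∑' j : ℕ, (1 / (-(2 * ((j : ℂ) + 1)) - (-1 / 2 + t * I)) -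
    1 / (-(2 * ((j : ℂ) + 1)) - (3 / 2 + t * I))) * (x : ℂ) ^ (-(2 * ((j : ℂ) + 1))) with hR
  set u : ℂ := (x : ℂ) ^ (-((t : ℂ) * I)) with hu
  refine ⟨G - L - Real.log (|t| + 2), -(u * R), ?_, ?_, ?_⟩
  · -- `E₁`
    have h := hC₁ t
    have e : G - L - Real.log (|t| + 2) = logDeriv Gammaℝ (-1 / 2 + t * I) +
        logDeriv Gammaℝ (1 - (-1 / 2 + t * I)) - LSeries (fun n ↦ (Λ n : ℂ)) (3 / 2 - t * I) -
          Real.log (|t| + 2) := by rw [hG, hL]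
    rw [e]
    exact h.trans (le_max_left _ _)
  · -- `E₂`
    have hu1 : ‖u‖ = 1 := by
      rw [hu, norm_cpow_eq_rpow_re_of_pos hx0]
      simp
    rw [norm_neg, norm_mul, hu1, one_mul]
    calc ‖R‖ ≤ 8 * (x ^ (-2 : ℝ) / (|t| + 2)) := Montgomery.norm_trivialZeroSeries_le hx t
      _ ≤ max C₁ 8 * (x ^ (-2 : ℝ) / (|t| + 2)) :=
          mul_le_mul_of_nonneg_right (le_max_right _ _) (by positivity)
  · -- the identity
    have e1 : (x : ℂ) ^ ((1 / 2 : ℂ) - t * I) = (x : ℂ) ^ (1 / 2 : ℂ) * u := by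
      rw [hu, sub_eq_add_neg, cpow_add _ _ hx0']
    have e2 : (x : ℂ) ^ (-1 / 2 + t * I) * u = (x : ℂ) ^ (-(1 / 2 : ℂ)) := by
      rw [hu, ← cpow_add _ _ hx0']
      congr 1
      ring
    have e3 : (x : ℂ) * u = (x : ℂ) ^ ((1 : ℂ) - t * I) := by
      rw [hu]
      calc (x : ℂ) * (x : ℂ) ^ (-((t : ℂ) * I)) = (x : ℂ) ^ (1 : ℂ) * (x : ℂ) ^ (-((t : ℂ) * I)) := by
            rw [cpow_one]
        _ = (x : ℂ) ^ ((1 : ℂ) - t * I) := by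
            rw [← cpow_add _ _ hx0', ← sub_eq_add_neg]
    have e4 : (x : ℂ) ^ ((t : ℂ) * I) * u = 1 := by
      rw [hu, ← cpow_add _ _ hx0', add_neg_cancel, cpow_zero]
    have h12 : (1 / 2 + (t : ℂ) * I) ≠ 0 := by
      intro h; have := congrArg re h; norm_num at this
    have h32 : (3 / 2 - (t : ℂ) * I) ≠ 0 := by
      intro h; have := congrArg re h; norm_num at this
    have ek : (1 / (1 - (-1 / 2 + (t : ℂ) * I)) - 1 / (1 - (3 / 2 + (t : ℂ) * I))) =
        2 / ((1 / 2 + t * I) * (3 / 2 - t * I)) := by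
      have ea : (1 - (-1 / 2 + (t : ℂ) * I)) = 3 / 2 - t * I := by ring
      have eb : (1 - (3 / 2 + (t : ℂ) * I)) = -(1 / 2 + t * I) := by ring
      rw [ea, eb, one_div_neg_eq_neg_one_div, sub_neg_eq_add, div_add_div _ _ h32 h12,
        div_eq_div_iff (mul_ne_zero h32 h12) (mul_ne_zero h12 h32)]
      ring
    calc 2 * (x : ℂ) ^ ((1 / 2 : ℂ) - t * I) * zeroKernelSeries x t
        = u * (2 * (x : ℂ) ^ (1 / 2 : ℂ) * zeroKernelSeries x t) := by rw [e1]; ring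
      _ = u * ((x : ℂ) ^ (-1 / 2 + t * I) * (G - L) +
            x * (1 / (1 - (-1 / 2 + t * I)) - 1 / (1 - (3 / 2 + t * I))) -
            (x : ℂ) ^ ((t : ℂ) * I) * montgomeryDirichletSum x t - R) := by rw [key]
      _ = ((x : ℂ) ^ (-1 / 2 + t * I) * u) * (G - L) +
            ((x : ℂ) * u) * (1 / (1 - (-1 / 2 + t * I)) - 1 / (1 - (3 / 2 + t * I))) -
            ((x : ℂ) ^ ((t : ℂ) * I) * u) * montgomeryDirichletSum x t - u * R := by ring
      _ = (x : ℂ) ^ (-(1 / 2 : ℂ)) * (G - L) +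
            (x : ℂ) ^ ((1 : ℂ) - t * I) * (2 / ((1 / 2 + t * I) * (3 / 2 - t * I))) -
            montgomeryDirichletSum x t - u * R := by rw [e2, e3, e4, ek, one_mul]
      _ = -montgomeryDirichletSum x t +
              2 * (x : ℂ) ^ ((1 : ℂ) - t * I) / ((1 / 2 + t * I) * (3 / 2 - t * I)) +
            (x : ℂ) ^ (-(1 / 2 : ℂ)) * (Real.log (|t| + 2) + (G - L - Real.log (|t| + 2))) +
            -(u * R) := by ring

end BGSTB2024

end Literature.NumberTheory.LFunctions

end
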